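import Summits.SmoothPoincare4.SmoothPoincare4.Theses.SymplecticOrigami
import Literature.Topology.FourManifolds.HomotopySpheres
import Literature.Topology.FourManifolds.Morse
import Literature.Topology.Immersions.OpenParallelizableImmersionHolds
import Literature.Topology.FourManifolds.HomotopySpheresStablyParallelizableProofs
import Literature.Topology.FourManifolds.HomotopySpheresGroupDischarge
import Literature.Topology.FourManifolds.HomotopySpheresProofs
import Literature.Topology.FourManifolds.StableFramingLift
import Literature.Topology.FourManifolds.ParallelizablePullback
import Literature.Topology.FourManifolds.GluckTwistProofs
import Literature.Geometry.Manifold.OpenSubmanifoldMFDeriv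
import Mathlib.Analysis.Normed.Module.Connected
import Mathlib.Topology.Homotopy.Contractible

/-!
# Stub `stub_fakeBallImmersion` of line `round-trace-continuity` for crux `OrigamiFoldExistence`
(item stmt-SmoothPoincare4-7844, route route-SmoothPoincare4-SymplecticOrigami)

**Fake balls immerse in `ℝ⁴`** (= route EuclideanOrigami's item `HirschPoenaruImmersion`,
stmt-SmoothPoincare4-7486, VERBATIM): for every homotopy 4-sphere `S` and smooth embedding
`e : ℝ⁴ → S` there is `F : S → ℝ⁴` which is a local diffeomorphism at every point outside `e(B̊⁴)`.

Route (all inputs are PROVED theorems of the tree):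

* `S ∖ {e 0}` is contractible (`HomotopySphere.contractibleSpace_compl_singleton_holds`,
  Kervaire–Milnor 1963, proof of Lemma 2.4) and `TS ⊕ ℝ` is framed over it
  (`HomotopySphere.hasStableTangentFramingAlong_compl_singleton_holds`, proof of Thm. 3.1);
* **Kervaire–Milnor's Lemma 3.4/3.5 mechanism on a compact piece**
  (`hasTangentFramingAlong_comp_of_contractibleSpace`, proved here): along any map of a compact
  space factoring through a contractible space over which `TM ⊕ ℝ` is framed, `TM` itself is
  framed — the Gauss map of the stable framing is null-homotopic through the contractible space,
  so the framing lifts (`hasTangentFramingAlong_of_homotopic_const`, `StableFramingLift.lean`);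
  applied to the compact `C = S ∖ e(B(0, ½)) ⊆ S ∖ {e 0}`;
* the open set `U = S ∖ e(B̄(0, ½)) ⊆ C`, with Mathlib's open-submanifold structure, is then
  parallelizable (`IsParallelizable.of_hasTangentFramingAlong_of_isInvertible_mfderiv` along the
  inclusion, whose differential is the identity, `OpenSubmanifold.mfderiv_subtype_val`);
* **Phillips 1967, Cor. 8.2 / Poenaru 1962, Thm. 5 / Hirsch 1961** — an open parallelizable
  `n`-manifold submerses in `ℝⁿ` — PROVED in the tree
  (`Literature.Topology.Immersions.Phillips1967_exists_isLocalDiffeomorph_of_isParallelizable_holds`),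
  read on the ambient manifold (`exists_isLocalDiffeomorphAt_of_isOpen_of_ne_univ`): some
  `F : S → ℝ⁴` is a local diffeomorphism at every point of `U ⊇ S ∖ e(B̊⁴)`.
-/

noncomputable section

-- the prescribed namespace `Summit.<P>.<Sub>.…` duplicates `SmoothPoincare4` (P = Sub)
set_option linter.dupNamespace false

open scoped Manifold ContDiff Topology
open Set Function Bundle Module Metric
open Literature.Topology.FourManifolds (HomotopySphere HasTangentFramingAlong
  HasStableTangentFramingAlong IsParallelizable hasTangentFramingAlong_of_homotopic_const)

namespace Summit.SmoothPoincare4.SmoothPoincare4.Theorems.OrigamiFoldExistence.RoundTraceContinuity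

section KervaireMilnorLift

variable {E H : Type*} [NormedAddCommGroup E] [NormedSpace ℝ E] [TopologicalSpace H]
  {I : ModelWithCorners ℝ E H} {M : Type*} [TopologicalSpace M] [ChartedSpace H M]
  [IsManifold I 1 M]

/-- **Kervaire–Milnor's Lemma 3.4/3.5 over a contractible space, on compact pieces.** Let
`g : Y → M` be a continuous map of a contractible space `Y` into a `C¹` manifold `M` of positive
dimension along which the stable tangent bundle `g*TM ⊕ ℝ` is framed, and let `j : C → Y` be a
continuous map of a compact space. Then `TM` is framed along `g ∘ j`. Indeed the Gauss map
`â = a/‖a‖ : Y → Sᵏ` of the stable framing `sᵢ = (vᵢ, aᵢ)` (`k = dim M`) is null-homotopic, `Y`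
being contractible and `Sᵏ` path connected, so over the compact `C` the framing lifts to a framing
of `TM` by the discrete covering homotopy of `O(k+1) → Sᵏ`
(`hasTangentFramingAlong_of_homotopic_const`; Kervaire–Milnor, *Groups of homotopy spheres I*
(1963), Lemma 3.5 and proof of Lemma 3.4, p. 509: "every map into a sphere of the same dimension
is null-homotopic"). -/
theorem hasTangentFramingAlong_comp_of_contractibleSpace {Y : Type*} [TopologicalSpace Y]
    [ContractibleSpace Y] {C : Type*} [TopologicalSpace C] [CompactSpace C]
    (hE : 0 < finrank ℝ E) {g : Y → M} (hg : Continuous g)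
    (h : HasStableTangentFramingAlong I M g) (j : C(C, Y)) :
    HasTangentFramingAlong I M (g ∘ j) := by
  obtain ⟨s, hs, hs', hli⟩ := h
  -- the coefficient vector `a` of the projection `g*TM ⊕ ℝ → ℝ` never vanishes
  have ha0 : ∀ p, (WithLp.toLp 2 fun i ↦ (s i p).2 :
      EuclideanSpace ℝ (Fin (finrank ℝ E + 1))) ≠ 0 := by
    intro p hp
    have h0 : ∀ i, (s i p).2 = 0 := fun i ↦ by
      have := congrArg (fun v : EuclideanSpace ℝ (Fin (finrank ℝ E + 1)) ↦ v i) hp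
      simpa using this
    have hli' : LinearIndependent ℝ fun i ↦ (s i p).1 := by
      refine LinearIndependent.of_comp (LinearMap.inl ℝ E ℝ) ?_
      convert hli p using 1
      funext i
      exact Prod.ext rfl (h0 i).symm
    haveI : FiniteDimensional ℝ E := FiniteDimensional.of_finrank_pos hE
    have hcard := hli'.fintype_card_le_finrank
    rw [Fintype.card_fin] at hcard
    omega
  have hac : Continuous fun p ↦ (WithLp.toLp 2 fun i ↦ (s i p).2 :
      EuclideanSpace ℝ (Fin (finrank ℝ E + 1))) :=
    (PiLp.continuous_toLp 2 _).comp (continuous_pi fun i ↦ hs' i)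
  -- the Gauss map `â : Y → Sᵏ`
  set φ : Y → EuclideanSpace ℝ (Fin (finrank ℝ E + 1)) := fun p ↦
    ‖(WithLp.toLp 2 fun i ↦ (s i p).2 : EuclideanSpace ℝ (Fin (finrank ℝ E + 1)))‖⁻¹ •
      (WithLp.toLp 2 fun i ↦ (s i p).2)
  have hφc : Continuous φ := (hac.norm.inv₀ fun p ↦ norm_ne_zero_iff.2 (ha0 p)).smul hac
  have hφ1 : ∀ p, ‖φ p‖ = 1 := fun p ↦ norm_smul_inv_norm (ha0 p)
  let Φ : C(Y, sphere (0 : EuclideanSpace ℝ (Fin (finrank ℝ E + 1))) 1) :=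
    ⟨fun p ↦ ⟨φ p, mem_sphere_zero_iff_norm.2 (hφ1 p)⟩, hφc.subtype_mk _⟩
  -- the north pole
  let N : sphere (0 : EuclideanSpace ℝ (Fin (finrank ℝ E + 1))) 1 :=
    ⟨EuclideanSpace.single (Fin.last (finrank ℝ E)) (1 : ℝ), by simp⟩
  -- `â` is null-homotopic (contractible source), to the north pole (path connected sphere)
  obtain ⟨y₀, hy₀⟩ := id_nullhomotopic Y
  have h1 : Φ.Homotopic (ContinuousMap.const Y (Φ y₀)) := by
    have h := (ContinuousMap.Homotopic.refl Φ).comp hy₀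
    rwa [ContinuousMap.comp_id, ContinuousMap.comp_const] at h
  have h2 : (ContinuousMap.const Y (Φ y₀)).Homotopic (ContinuousMap.const Y N) := by
    haveI : Nonempty Y := ⟨y₀⟩
    rw [ContinuousMap.homotopic_const_iff]
    have hrank : 1 < Module.rank ℝ (EuclideanSpace ℝ (Fin (finrank ℝ E + 1))) := by
      rw [← Module.finrank_eq_rank, finrank_euclideanSpace_fin]
      exact_mod_cast Nat.succ_lt_succ hE
    exact ((isPathConnected_sphere hrank (0 : EuclideanSpace ℝ (Fin (finrank ℝ E + 1)))
      zero_le_one).joinedIn _ (Φ y₀).2 _ N.2).joined_subtype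
  obtain ⟨G⟩ := (h1.trans h2).symm
  -- lift the framing along the null-homotopy, over the compact `C`
  refine hasTangentFramingAlong_of_homotopic_const (f := g ∘ j) (hg.comp j.continuous)
    (fun i p ↦ s i (j p)) (fun i ↦ (hs i).comp j.continuous) (fun p ↦ hli (j p))
    (fun q ↦ ((G (q.1, j q.2) : sphere (0 : EuclideanSpace ℝ (Fin (finrank ℝ E + 1))) 1) :
      EuclideanSpace ℝ (Fin (finrank ℝ E + 1)))) ?_ (fun q ↦ norm_eq_of_mem_sphere _)
    (fun p ↦ ?_) (fun p ↦ ?_)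
  · exact continuous_subtype_val.comp
      (G.continuous.comp (continuous_fst.prodMk (j.continuous.comp continuous_snd)))
  · exact congrArg Subtype.val (G.apply_zero (j p))
  · exact congrArg Subtype.val (G.apply_one (j p))

end KervaireMilnorLift

/-- **Stub `stub_fakeBallImmersion` (fake balls immerse; = route EuclideanOrigami's item
`HirschPoenaruImmersion`, stmt-SmoothPoincare4-7486, VERBATIM).** For every homotopy 4-sphere `S` and smooth
embedding `e : ℝ⁴ → S` there is `F : S → ℝ⁴` which is a local diffeomorphism at every point outside
`e(B̊⁴)`.  Hirsch 1959 / Poenaru 1962 / Phillips 1967, Cor. 8.2 (the h-principle is PROVED in tree: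
`Literature.Topology.Immersions.Phillips1967_exists_isLocalDiffeomorph_of_isParallelizable_holds`), applied to
the proper open subset `U = S ∖ e(B̄(0, ½))`, which is parallelizable: `TS ⊕ ℝ` is framed over the
contractible `S ∖ {e 0}` (Kervaire–Milnor 1963, proofs of Lemma 2.4 and Thm. 3.1), hence `TS` is framed over
the compact `S ∖ e(B(0, ½)) ⊇ U` (Lemma 3.4/3.5, `hasTangentFramingAlong_comp_of_contractibleSpace`). -/
theorem stub_fakeBallImmersion :
    ∀ (S : Literature.Topology.FourManifolds.HomotopySphere 4) (e : EuclideanSpace ℝ (Fin 4) → S.carrier), Manifold.IsSmoothEmbedding (𝓡 4) (𝓡 4) ∞ e → ∃ F : S.carrier → EuclideanSpace ℝ (Fin 4), ∀ x, x ∉ e '' Metric.ball (0 : EuclideanSpace ℝ (Fin 4)) 1 → IsLocalDiffeomorphAt (𝓡 4) (𝓡 4) ∞ F x := by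
  intro S e he
  haveI := S.connectedSpace (by norm_num)
  -- `e` is an open map (invariance of domain for equidimensional smooth embeddings)
  have hopen : IsOpenMap e :=
    Literature.Topology.FourManifolds.Manifold.IsSmoothEmbedding.isOpenMap_of_finrank_eq he rfl
  have hcont : Continuous e := he.contMDiff.continuous
  -- the punctured homotopy sphere `S ∖ {e 0}`: contractible, `TS ⊕ ℝ` framed over it
  haveI : ContractibleSpace ((({e 0} : Set S.carrier)ᶜ : Set S.carrier)) :=
    HomotopySphere.contractibleSpace_compl_singleton_holds 4 S (e 0) (by norm_num)
  have hstab : HasStableTangentFramingAlong (𝓡 4) S.carrier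
      ((↑) : ((({e 0} : Set S.carrier)ᶜ : Set S.carrier)) → S.carrier) :=
    HomotopySphere.hasStableTangentFramingAlong_compl_singleton_holds 4 S (e 0)
  -- the compact piece `C = S ∖ e(B(0, ½)) ⊆ S ∖ {e 0}`
  set C : Set S.carrier := (e '' ball (0 : EuclideanSpace ℝ (Fin 4)) 2⁻¹)ᶜ with hC_def
  have hCc : IsClosed C := (hopen _ isOpen_ball).isClosed_compl
  haveI : CompactSpace C := isCompact_iff_compactSpace.mp hCc.isCompact
  have hCsub : C ⊆ (({e 0} : Set S.carrier)ᶜ : Set S.carrier) := by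
    intro x hx h0
    rw [mem_singleton_iff] at h0
    exact hx ⟨0, mem_ball_self (by norm_num), h0.symm⟩
  let j : C(C, ((({e 0} : Set S.carrier)ᶜ : Set S.carrier))) :=
    ⟨Set.inclusion hCsub, continuous_inclusion hCsub⟩
  have hC : HasTangentFramingAlong (𝓡 4) S.carrier
      (((↑) : ((({e 0} : Set S.carrier)ᶜ : Set S.carrier)) → S.carrier) ∘ j) :=
    hasTangentFramingAlong_comp_of_contractibleSpace (by simp) continuous_subtype_val hstab j
  -- the open piece `U = S ∖ e(B̄(0, ½)) ⊆ C`, an open submanifold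
  let U : TopologicalSpace.Opens S.carrier :=
    ⟨(e '' closedBall (0 : EuclideanSpace ℝ (Fin 4)) 2⁻¹)ᶜ,
      ((isCompact_closedBall _ _).image hcont).isClosed.isOpen_compl⟩
  have hUC : (U : Set S.carrier) ⊆ C :=
    compl_subset_compl.mpr (image_mono ball_subset_closedBall)
  have hU : HasTangentFramingAlong (𝓡 4) S.carrier (Subtype.val : U → S.carrier) :=
    hC.comp ⟨Set.inclusion hUC, continuous_inclusion hUC⟩
  -- `U` is parallelizable: pull the framing back along the inclusion (identity differential)
  have hpar : IsParallelizable (𝓡 4) U :=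
    IsParallelizable.of_hasTangentFramingAlong_of_isInvertible_mfderiv
      (I := 𝓡 4) (I' := 𝓡 4) (φ := (Subtype.val : U → S.carrier)) contMDiff_subtype_val
      (fun x ↦ by
        rw [Literature.Geometry.Manifold.OpenSubmanifold.mfderiv_subtype_val (I := 𝓡 4)]
        exact ⟨ContinuousLinearEquiv.refl ℝ _, rfl⟩) hU
  -- `U ≠ S`: the centre `e 0` is removed
  have hUne : (U : Set S.carrier) ≠ univ := by
    intro h
    have h0 : e 0 ∈ (U : Set S.carrier) := by rw [h]; exact mem_univ _
    exact h0 ⟨0, mem_closedBall_self (by norm_num), rfl⟩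
  -- Phillips 1967, Cor. 8.2, on the proper open parallelizable `U ⊊ S`
  obtain ⟨F, hF⟩ := Literature.Topology.Immersions.exists_isLocalDiffeomorphAt_of_isOpen_of_ne_univ
    Literature.Topology.Immersions.Phillips1967_exists_isLocalDiffeomorph_of_isParallelizable_holds
    U hUne hpar
  refine ⟨F, fun x hx ↦ hF x ?_⟩
  -- a point outside `e(B̊⁴)` lies outside `e(B̄(0, ½))`
  rintro ⟨y, hy, rfl⟩
  exact hx ⟨y, mem_ball_zero_iff.2 (lt_of_le_of_lt (mem_closedBall_zero_iff.1 hy) (by norm_num)),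
    rfl⟩

end Summit.SmoothPoincare4.SmoothPoincare4.Theorems.OrigamiFoldExistence.RoundTraceContinuity

end
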